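import Mathlib.Analysis.SpecialFunctions.Pow.Real
import Summits.PneNP.PneNP.Theorems.OneSliceSliceACZeroDefs

/-!
# Route OneSlice, item `ShallowSliceBound` (stmt-PneNP-14083): growing a random sub-cube by one coordinate

Helper file (prover seat, 2026-08-16), def-free (vocabulary: `wt`, `upPivotal` of
`Theorems/OneSliceSliceACZeroDefs.lean`). Write `y ∧ 1_T = fun e => if e ∈ T then y e else false` and
`Φ_g(r) = Σ_{|T| = r} #{y : g(y ∧ 1_T) = 1}`. For a MONOTONE `g`:

* `card_subcube_eq_add` — adding the coordinate `e` to the sub-cube raises the count by the number of pivotal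
  UP-edges in direction `e`: `#{y : g(y ∧ 1_T)} = #{y : g(y ∧ 1_{T∖e})} + #{z : z_e = 0, e pivotal for g(· ∧ 1_T) at z}`;
* `sum_card_pivDir_eq_card_upPivotal` — summed over `e ∈ T` these are all pivotal UP-edges of `g(· ∧ 1_T)`;
* `sum_sum_erase_eq` — double counting `Σ_{|T|=r+1} Σ_{e ∈ T} F(T ∖ e) = (N - r) Σ_{|S| = r} F(S)`;
* `succ_mul_subcube_sum_eq` — the exact identity `(r+1) Φ_g(r+1) = (N-r) Φ_g(r) + Σ_{|T|=r+1} #upPivotal(g(· ∧ 1_T))`;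
* `subcube_avg_succ_le` / `subcube_avg_le_of_le` — with a uniform bound `2 #upPivotal(g(· ∧ 1_T)) ≤ 2^N Λ` the
  normalised averages `Φ_g(r)/(C(N,r) 2^N)` grow by at most `Λ/(2(r+1))` per step, hence by at most
  `Λ (r₂ - r₁)/(2(r₁ + 1))` from `r₁` to `r₂`.
-/

set_option linter.dupNamespace false

noncomputable section

namespace Summit.PneNP.PneNP.Theorems.ShallowSliceBound

open Finset
open Summit.PneNP.PneNP.Cruxes.SliceACZero.RussoWindowLadder (wt upPivotal)

variable {ι : Type} [Fintype ι] [DecidableEq ι]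

/-! ### One coordinate -/

omit [Fintype ι] in
/-- `y ∧ 1_T` is monotone in `y`. [folklore] -/
theorem subcube_mono (T : Finset ι) {y y' : ι → Bool} (h : y ≤ y') :
    (fun e => if e ∈ T then y e else false) ≤ (fun e => if e ∈ T then y' e else false) := by
  intro e; by_cases he : e ∈ T <;> simp [he, h e]

omit [Fintype ι] in
/-- Removing `e` from `T` is setting `y_e := 0`. [folklore] -/
theorem subcube_erase_eq (T : Finset ι) (e : ι) (y : ι → Bool) :
    (fun e' => if e' ∈ T.erase e then y e' else false) =
      (fun e' => if e' ∈ T then (Function.update y e false) e' else false) := by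
  funext e'
  by_cases h : e' = e
  · subst h; simp
  · simp [h, mem_erase]

omit [Fintype ι] in
/-- `y ∧ 1_T` does not depend on `y_e` for `e ∉ T`. [folklore] -/
theorem subcube_update_of_notMem {T : Finset ι} {e : ι} (he : e ∉ T) (y : ι → Bool) (b : Bool) :
    (fun e' => if e' ∈ T then (Function.update y e b) e' else false) = (fun e' => if e' ∈ T then y e' else false) := by
  funext e'
  by_cases h : e' = e
  · subst h; simp [he]
  · simp [h]

/-- **Adding one coordinate to the sub-cube**: for monotone `g` and `e ∈ T`,
`#{y : g(y ∧ 1_T)} = #{y : g(y ∧ 1_{T∖e})} + #{z : z_e = 0, g(z ∧ 1_T) ≠ g(z|ₑ₌₁ ∧ 1_T)}`. [folklore] -/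
theorem card_subcube_eq_add {g : (ι → Bool) → Bool} (hg : Monotone g) (T : Finset ι) {e : ι} (he : e ∈ T) :
    #(univ.filter fun y : ι → Bool => g (fun e' => if e' ∈ T then y e' else false) = true) =
      #(univ.filter fun y : ι → Bool => g (fun e' => if e' ∈ T.erase e then y e' else false) = true) +
      #(univ.filter fun z : ι → Bool => z e = false ∧
        g (fun e' => if e' ∈ T then z e' else false) ≠
          g (fun e' => if e' ∈ T then (Function.update z e true) e' else false)) := by
  set G : (ι → Bool) → Bool := fun y => g (fun e' => if e' ∈ T then y e' else false) with hG
  have hGmono : Monotone G := fun y y' h => hg (subcube_mono T h)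
  have hGe : ∀ y, g (fun e' => if e' ∈ T.erase e then y e' else false) = G (Function.update y e false) := by
    intro y; rw [subcube_erase_eq]
  simp only [hGe]
  change #(univ.filter fun y => G y = true) = #(univ.filter fun y => G (Function.update y e false) = true) +
    #(univ.filter fun z : ι → Bool => z e = false ∧ G z ≠ G (Function.update z e true))
  -- split `{G = 1}` according to `G(y|ₑ₌₀)`
  rw [← Finset.card_filter_add_card_filter_not (s := univ.filter fun y => G y = true)
    (fun y => G (Function.update y e false) = true), filter_filter, filter_filter]
  congr 1
  · congr 1
    refine filter_congr fun y _ => ⟨fun h => h.2, fun h => ⟨?_, h⟩⟩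
    have hle : Function.update y e false ≤ y := by
      intro i; by_cases hi : i = e
      · subst hi; simp
      · simp [hi]
    have := hGmono hle
    rw [h] at this
    revert this; cases G y <;> simp
  · refine card_bij' (fun y _ => Function.update y e false) (fun z _ => Function.update z e true) ?_ ?_ ?_ ?_
    · intro y hy
      simp only [mem_filter, mem_univ, true_and] at hy ⊢
      refine ⟨by simp, ?_⟩
      have hye : y e = true := by
        by_contra hne
        have hf : y e = false := by revert hne; cases y e <;> simp
        have : Function.update y e false = y := by rw [← hf]; exact Function.update_eq_self e y
        rw [this] at hy; exact hy.2 hy.1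
      have hy' : Function.update y e true = y := by rw [← hye]; exact Function.update_eq_self e y
      rw [Function.update_idem, hy', hy.1]
      revert hy; cases G (Function.update y e false) <;> simp
    · intro z hz
      simp only [mem_filter, mem_univ, true_and] at hz ⊢
      rw [Function.update_idem]
      have hz0 : Function.update z e false = z := by rw [← hz.1]; exact Function.update_eq_self e z
      rw [hz0]
      have hle : z ≤ Function.update z e true := by
        intro i; by_cases hi : i = e
        · subst hi; simp
        · simp [hi]
      have hmono := hGmono hle
      revert hmono hz
      cases G z <;> cases G (Function.update z e true) <;> simp
    · intro y hy
      simp only [mem_filter, mem_univ, true_and] at hy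
      rw [Function.update_idem]
      have hye : y e = true := by
        by_contra hne
        have hf : y e = false := by revert hne; cases y e <;> simp
        have : Function.update y e false = y := by rw [← hf]; exact Function.update_eq_self e y
        rw [this] at hy; exact hy.2 hy.1
      rw [← hye]; exact Function.update_eq_self e y
    · intro z hz
      simp only [mem_filter, mem_univ, true_and] at hz
      rw [Function.update_idem, ← hz.1]; exact Function.update_eq_self e z

/-- **The pivotal UP-edges of `g(· ∧ 1_T)` all point in directions `e ∈ T`**:
`Σ_{e ∈ T} #{z : z_e = 0, e pivotal at z} = #upPivotal(g(· ∧ 1_T))`. [folklore] -/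
theorem sum_card_pivDir_eq_card_upPivotal (g : (ι → Bool) → Bool) (T : Finset ι) :
    ∑ e ∈ T, #(univ.filter fun z : ι → Bool => z e = false ∧
        g (fun e' => if e' ∈ T then z e' else false) ≠
          g (fun e' => if e' ∈ T then (Function.update z e true) e' else false)) =
      #(upPivotal (fun y : ι → Bool => g (fun e' => if e' ∈ T then y e' else false))) := by
  set G : (ι → Bool) → Bool := fun y => g (fun e' => if e' ∈ T then y e' else false) with hG
  change ∑ e ∈ T, #(univ.filter fun z : ι → Bool => z e = false ∧ G z ≠ G (Function.update z e true)) = #(upPivotal G)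
  have hall : #(upPivotal G) = ∑ e, #(univ.filter fun z : ι → Bool => z e = false ∧ G z ≠ G (Function.update z e true)) := by
    rw [upPivotal, Finset.card_filter, ← Finset.univ_product_univ, Finset.sum_product_right]
    refine Finset.sum_congr rfl fun i _ => ?_
    rw [Finset.card_filter]
  rw [hall]
  refine sum_subset (subset_univ T) fun e _ he => ?_
  rw [card_eq_zero, filter_eq_empty_iff]
  intro z _ hz
  apply hz.2
  rw [hG]; dsimp only
  rw [subcube_update_of_notMem he]

/-- **Double counting**: `Σ_{|T| = r+1} Σ_{e ∈ T} F(T ∖ e) = (N - r) Σ_{|S| = r} F(S)`. [folklore] -/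
theorem sum_sum_erase_eq (r : ℕ) (F : Finset ι → ℕ) :
    ∑ T ∈ powersetCard (r + 1) (univ : Finset ι), ∑ e ∈ T, F (T.erase e) =
      (Fintype.card ι - r) * ∑ S ∈ powersetCard r (univ : Finset ι), F S := by
  have hR : (Fintype.card ι - r) * ∑ S ∈ powersetCard r (univ : Finset ι), F S =
      ∑ S ∈ powersetCard r (univ : Finset ι), ∑ e ∈ univ \ S, F S := by
    rw [mul_sum]
    refine sum_congr rfl fun S hS => ?_
    rw [mem_powersetCard] at hS
    rw [sum_const, smul_eq_mul, card_sdiff_of_subset (subset_univ S), card_univ, hS.2]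
  rw [hR, sum_sigma', sum_sigma']
  refine sum_bij' (fun x _ => ⟨x.1.erase x.2, x.2⟩) (fun x _ => ⟨insert x.2 x.1, x.2⟩) ?_ ?_ ?_ ?_ ?_
  · rintro ⟨T, e⟩ hx
    simp only [mem_sigma, mem_powersetCard] at hx ⊢
    refine ⟨⟨subset_univ _, ?_⟩, ?_⟩
    · rw [card_erase_of_mem hx.2, hx.1.2]; rfl
    · simp
  · rintro ⟨S, e⟩ hx
    simp only [mem_sigma, mem_powersetCard, mem_sdiff, mem_univ, true_and] at hx ⊢
    refine ⟨⟨subset_univ _, ?_⟩, mem_insert_self e S⟩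
    rw [card_insert_of_notMem hx.2, hx.1.2]
  · rintro ⟨T, e⟩ hx
    simp only [mem_sigma] at hx
    simp [insert_erase hx.2]
  · rintro ⟨S, e⟩ hx
    simp only [mem_sigma, mem_sdiff, mem_univ, true_and] at hx
    simp [erase_insert hx.2]
  · rintro ⟨T, e⟩ _
    rfl

/-- **The growth identity**: for monotone `g`,
`(r+1) Φ_g(r+1) = (N - r) Φ_g(r) + Σ_{|T|=r+1} #upPivotal(g(· ∧ 1_T))`. [folklore] -/
theorem succ_mul_subcube_sum_eq {g : (ι → Bool) → Bool} (hg : Monotone g) (r : ℕ) :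
    (r + 1) * ∑ T ∈ powersetCard (r + 1) (univ : Finset ι),
        #(univ.filter fun y : ι → Bool => g (fun e' => if e' ∈ T then y e' else false) = true) =
      (Fintype.card ι - r) * ∑ S ∈ powersetCard r (univ : Finset ι),
        #(univ.filter fun y : ι → Bool => g (fun e' => if e' ∈ S then y e' else false) = true) +
      ∑ T ∈ powersetCard (r + 1) (univ : Finset ι),
        #(upPivotal (fun y : ι → Bool => g (fun e' => if e' ∈ T then y e' else false))) := by
  rw [← sum_sum_erase_eq r (fun S => #(univ.filter fun y : ι → Bool =>
    g (fun e' => if e' ∈ S then y e' else false) = true)), ← sum_add_distrib, mul_sum]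
  refine sum_congr rfl fun T hT => ?_
  rw [mem_powersetCard] at hT
  rw [← sum_card_pivDir_eq_card_upPivotal g T, ← sum_add_distrib]
  rw [← hT.2, ← smul_eq_mul, ← sum_const]
  exact sum_congr rfl fun e he => card_subcube_eq_add hg T he

/-- `(r+1) C(N, r+1) = (N - r) C(N, r)`. [folklore] -/
theorem succ_mul_choose_succ_eq (N r : ℕ) : (r + 1) * N.choose (r + 1) = (N - r) * N.choose r := by
  have := Nat.choose_succ_right_eq N r
  linarith [mul_comm (N.choose (r + 1)) (r + 1), mul_comm (N.choose r) (N - r)]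

/-- **One step**: if `2 #upPivotal(g(· ∧ 1_T)) ≤ 2^N Λ` for all `|T| = r + 1` (`r < N`, `g` monotone) then
`Φ_g(r+1)/(C(N,r+1) 2^N) ≤ Φ_g(r)/(C(N,r) 2^N) + Λ/(2(r+1))`. [folklore] -/
theorem subcube_avg_succ_le {g : (ι → Bool) → Bool} (hg : Monotone g) {r : ℕ} (hr : r < Fintype.card ι)
    {Λ : ℝ} (hΛ : ∀ T ∈ powersetCard (r + 1) (univ : Finset ι),
      2 * (#(upPivotal (fun y : ι → Bool => g (fun e' => if e' ∈ T then y e' else false))) : ℝ) ≤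
        2 ^ Fintype.card ι * Λ) :
    ((∑ T ∈ powersetCard (r + 1) (univ : Finset ι),
        #(univ.filter fun y : ι → Bool => g (fun e' => if e' ∈ T then y e' else false) = true) : ℕ) : ℝ) /
        (((Fintype.card ι).choose (r + 1) : ℝ) * 2 ^ Fintype.card ι) ≤
      ((∑ S ∈ powersetCard r (univ : Finset ι),
        #(univ.filter fun y : ι → Bool => g (fun e' => if e' ∈ S then y e' else false) = true) : ℕ) : ℝ) /
        (((Fintype.card ι).choose r : ℝ) * 2 ^ Fintype.card ι) + Λ / (2 * (r + 1)) := by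
  set N := Fintype.card ι with hN
  set Φ1 : ℕ := ∑ T ∈ powersetCard (r + 1) (univ : Finset ι),
    #(univ.filter fun y : ι → Bool => g (fun e' => if e' ∈ T then y e' else false) = true) with hΦ1
  set Φ0 : ℕ := ∑ S ∈ powersetCard r (univ : Finset ι),
    #(univ.filter fun y : ι → Bool => g (fun e' => if e' ∈ S then y e' else false) = true) with hΦ0
  have hid := succ_mul_subcube_sum_eq hg r (ι := ι)
  rw [← hΦ1, ← hΦ0] at hid
  have hpiv : ((∑ T ∈ powersetCard (r + 1) (univ : Finset ι),
      #(upPivotal (fun y : ι → Bool => g (fun e' => if e' ∈ T then y e' else false))) : ℕ) : ℝ) ≤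
      (N.choose (r + 1) : ℝ) * 2 ^ N * Λ / 2 := by
    push_cast
    have h2 : ∀ T ∈ powersetCard (r + 1) (univ : Finset ι),
        (#(upPivotal (fun y : ι → Bool => g (fun e' => if e' ∈ T then y e' else false))) : ℝ) ≤ 2 ^ N * Λ / 2 :=
      fun T hT => by linarith [hΛ T hT]
    refine (sum_le_sum h2).trans ?_
    rw [sum_const, card_powersetCard, card_univ, nsmul_eq_mul]
    linarith
  have hidR : ((r : ℝ) + 1) * Φ1 = ((N - r : ℕ) : ℝ) * Φ0 +
      ((∑ T ∈ powersetCard (r + 1) (univ : Finset ι),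
        #(upPivotal (fun y : ι → Bool => g (fun e' => if e' ∈ T then y e' else false))) : ℕ) : ℝ) := by
    exact_mod_cast hid
  have hchoose : ((r : ℝ) + 1) * (N.choose (r + 1) : ℝ) = ((N - r : ℕ) : ℝ) * (N.choose r : ℝ) := by
    exact_mod_cast succ_mul_choose_succ_eq N r
  have hc1 : (0 : ℝ) < N.choose (r + 1) := by exact_mod_cast Nat.choose_pos hr
  have hc0 : (0 : ℝ) < N.choose r := by exact_mod_cast Nat.choose_pos hr.le
  have hNr : (0 : ℝ) < ((N - r : ℕ) : ℝ) := by exact_mod_cast Nat.sub_pos_of_lt hr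
  have h2N : (0 : ℝ) < (2 : ℝ) ^ N := by positivity
  have hr1 : (0 : ℝ) < (r : ℝ) + 1 := by positivity
  set P : ℕ := ∑ T ∈ powersetCard (r + 1) (univ : Finset ι),
    #(upPivotal (fun y : ι → Bool => g (fun e' => if e' ∈ T then y e' else false))) with hP
  set C1 : ℝ := (N.choose (r + 1) : ℝ) with hC1
  set C0 : ℝ := (N.choose r : ℝ) with hC0
  have hden : ((N - r : ℕ) : ℝ) * (C0 * 2 ^ N) = ((r : ℝ) + 1) * C1 * 2 ^ N := by
    rw [← mul_assoc, ← hchoose]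
  calc (Φ1 : ℝ) / (C1 * 2 ^ N)
      = (((r : ℝ) + 1) * Φ1) / (((r : ℝ) + 1) * (C1 * 2 ^ N)) := by rw [mul_div_mul_left _ _ hr1.ne']
    _ = (((N - r : ℕ) : ℝ) * Φ0 + P) / (((N - r : ℕ) : ℝ) * (C0 * 2 ^ N)) := by
        rw [hidR, ← mul_assoc ((r : ℝ) + 1), hchoose, mul_assoc]
    _ = (Φ0 : ℝ) / (C0 * 2 ^ N) + (P : ℝ) / (((N - r : ℕ) : ℝ) * (C0 * 2 ^ N)) := by
        rw [add_div, mul_div_mul_left _ _ hNr.ne']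
    _ ≤ (Φ0 : ℝ) / (C0 * 2 ^ N) + (C1 * 2 ^ N * Λ / 2) / (((N - r : ℕ) : ℝ) * (C0 * 2 ^ N)) := by
        gcongr
    _ = (Φ0 : ℝ) / (C0 * 2 ^ N) + Λ / (2 * (r + 1)) := by
        rw [hden]
        congr 1
        field_simp

/-- **From `r₁` to `r₂`**: if `2 #upPivotal(g(· ∧ 1_T)) ≤ 2^N Λ` for all `T` with `r₁ < |T| ≤ r₂` (`r₂ ≤ N`,
`g` monotone, `Λ ≥ 0`) then `Φ_g(r₂)/(C(N,r₂) 2^N) ≤ Φ_g(r₁)/(C(N,r₁) 2^N) + Λ (r₂ - r₁)/(2 (r₁ + 1))`. [folklore] -/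
theorem subcube_avg_le_of_le {g : (ι → Bool) → Bool} (hg : Monotone g) {r₁ r₂ : ℕ} (h12 : r₁ ≤ r₂)
    (hr₂ : r₂ ≤ Fintype.card ι) {Λ : ℝ} (hΛ0 : 0 ≤ Λ)
    (hΛ : ∀ T : Finset ι, r₁ < #T → #T ≤ r₂ →
      2 * (#(upPivotal (fun y : ι → Bool => g (fun e' => if e' ∈ T then y e' else false))) : ℝ) ≤
        2 ^ Fintype.card ι * Λ) :
    ((∑ T ∈ powersetCard r₂ (univ : Finset ι),
        #(univ.filter fun y : ι → Bool => g (fun e' => if e' ∈ T then y e' else false) = true) : ℕ) : ℝ) /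
        (((Fintype.card ι).choose r₂ : ℝ) * 2 ^ Fintype.card ι) ≤
      ((∑ S ∈ powersetCard r₁ (univ : Finset ι),
        #(univ.filter fun y : ι → Bool => g (fun e' => if e' ∈ S then y e' else false) = true) : ℕ) : ℝ) /
        (((Fintype.card ι).choose r₁ : ℝ) * 2 ^ Fintype.card ι) + Λ * (r₂ - r₁) / (2 * (r₁ + 1)) := by
  induction r₂, h12 using Nat.le_induction with
  | base => simp
  | succ k hk ih =>
    have ih' := ih (by omega) (fun T h1 h2 => hΛ T h1 (by omega))
    have hstep := subcube_avg_succ_le hg (r := k) (by omega) (Λ := Λ)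
      (fun T hT => hΛ T (by rw [(mem_powersetCard.1 hT).2]; omega) (by rw [(mem_powersetCard.1 hT).2]))
    have hk1 : (0 : ℝ) < (k : ℝ) + 1 := by positivity
    have hr1 : (0 : ℝ) < (r₁ : ℝ) + 1 := by positivity
    have hkr : (r₁ : ℝ) ≤ (k : ℝ) := by exact_mod_cast hk
    have h1 : Λ / (2 * ((k : ℝ) + 1)) ≤ Λ / (2 * ((r₁ : ℝ) + 1)) :=
      div_le_div_of_nonneg_left hΛ0 (by positivity) (by linarith)
    have h2 : Λ * ((k : ℝ) - r₁) / (2 * (r₁ + 1)) + Λ / (2 * ((r₁ : ℝ) + 1)) =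
        Λ * ((k : ℝ) + 1 - r₁) / (2 * (r₁ + 1)) := by
      field_simp
      ring
    push_cast at ih' hstep ⊢
    linarith [hstep, ih', h1, h2]

/-- **Registered form** (sub-goal `subcube_avg_drift` of stmt-PneNP-14083): the drift bound for the normalised
sub-cube averages of a monotone function, all binders explicit. [folklore] -/
theorem subcube_avg_drift :
    ∀ (ι : Type) [Fintype ι] [DecidableEq ι] (g : (ι → Bool) → Bool), Monotone g → ∀ (r₁ r₂ : ℕ), r₁ ≤ r₂ →
      r₂ ≤ Fintype.card ι → ∀ Λ : ℝ, 0 ≤ Λ →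
      (∀ T : Finset ι, r₁ < #T → #T ≤ r₂ →
        2 * (#(upPivotal (fun y : ι → Bool => g (fun e' => if e' ∈ T then y e' else false))) : ℝ) ≤
          2 ^ Fintype.card ι * Λ) →
      ((∑ T ∈ powersetCard r₂ (univ : Finset ι),
          #(univ.filter fun y : ι → Bool => g (fun e' => if e' ∈ T then y e' else false) = true) : ℕ) : ℝ) /
          (((Fintype.card ι).choose r₂ : ℝ) * 2 ^ Fintype.card ι) ≤
        ((∑ S ∈ powersetCard r₁ (univ : Finset ι),
          #(univ.filter fun y : ι → Bool => g (fun e' => if e' ∈ S then y e' else false) = true) : ℕ) : ℝ) /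
          (((Fintype.card ι).choose r₁ : ℝ) * 2 ^ Fintype.card ι) + Λ * (r₂ - r₁) / (2 * (r₁ + 1)) :=
  fun _ _ _ _ hg _ _ h12 hr₂ _ hΛ0 hΛ => subcube_avg_le_of_le hg h12 hr₂ hΛ0 hΛ

end Summit.PneNP.PneNP.Theorems.ShallowSliceBound

end
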